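import Mathlib
import Summits.MatrixMultiplication.MatrixMultiplication.Theorems.SnSubsetDichotomyPolynomialSlackSpreadLevelOne

/-!
# The restricted (light-cell) level-one inequality for sets of permutations

Crux `Summit.MatrixMultiplication.MatrixMultiplication.Theses.SnSubsetDichotomy.PolynomialSlack`
(item `stmt-MatrixMultiplication-8306`), level-one programme, line transport-split-hull (lead c6).
For `X ⊆ S_n` with marginals `M_X(i,j) = #{x ∈ X : x j = i}` the tree theorem `spread_level_one`
bounds the full level-one energy `Σ_{i,j} (M_X(i,j) - |X|/n)²` by
`100·(1 + log n)·λ·(|X|²/n)·log(4n·n!/|X|)` under the GLOBAL spreadness hypothesis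
`M_X(i,j) ≤ λ|X|/n` for all `i, j`. Here we prove the RESTRICTED version with no hypothesis at all:
the same bound for the energy carried by the LIGHT cells `{(i,j) : M_X(i,j) < λ|X|/n}` only,

  `Σ_{M_X(i,j) < λ|X|/n} (M_X(i,j) - |X|/n)² ≤ 100·(1 + log n)·λ·(|X|²/n)·log(4n·n!/|X|)`
                                                                    (`restricted_level_one`).

The proof is the proof of `spread_level_one` with the test function `η` SUPPORTED ON THE LIGHT CELLS,
`η = (M - |X|/n)·n/(λ|X|)` there and `0` on the heavy cells, so `η ∈ [-1, 1]`; the column sums of `η`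
no longer vanish, so the mean `m = (Σ η)/n ∈ [-n, n]` of the level-one statistic `F(π) = Σ_j η(π j, j)`
over `S_n` is kept inside the Bernstein inequality for permuted sums `card_permutedSum_tail_le`; the
KEY IDENTITY becomes `Σ_{x∈X} (F(x) - m) = λ|X|v` EXACTLY (`v = Ση²/n`, since cellwise
`η·M = (|X|/n)η + (λ|X|/n)η²`), and `F - m ≤ 2n` with tail mass `≤ |X|/n` at the threshold
`t₀ = √(64(1+log n)vL) + 16L`, `L = log(4n·n!/|X|)`, gives `λv ≤ t₀ + 2 ≤ 100(1+log n)L`.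
-/

namespace Summit.MatrixMultiplication.MatrixMultiplication.Theorems.PolynomialSlack

open scoped BigOperators

set_option linter.dupNamespace false

set_option maxHeartbeats 800000 in
/-- **Restricted (light-cell) level-one inequality.** For `X ⊆ S_n` non-empty and `λ ≥ 1`,
`Σ_{(i,j) : #{x ∈ X : x j = i} < λ|X|/n} (#{x ∈ X : x j = i} - |X|/n)²
  ≤ 100·(1 + log n)·λ·(|X|²/n)·log(4n·n!/|X|)`, with NO spreadness hypothesis.
Proof: Bernstein for permuted sums (`card_permutedSum_tail_le`) on `F(π) = Σ_j η(π j, j)` with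
`η = (M - |X|/n)·n/(λ|X|)` on the light cells and `0` on the heavy ones, `η ∈ [-1,1]`, mean
`m ∈ [-n, n]` over `S_n`, `Σ_{x ∈ X} (F(x) - m) = λ|X|v` (`v = Ση²/n`), `F - m ≤ 2n`,
threshold `t₀ = √(64(1+log n)vL) + 16L`; then `λv ≤ t₀ + 2` and AM–GM. [folklore] -/
theorem restricted_level_one {n : ℕ} (hn : 1 ≤ n) (X : Finset (Equiv.Perm (Fin n))) (hX : X.Nonempty)
    (lam : ℝ) (hlam : 1 ≤ lam) :
    ∑ i : Fin n, ∑ j : Fin n,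
        (if ((X.filter fun x => x j = i).card : ℝ) < lam * X.card / n then
          (((X.filter fun x => x j = i).card : ℝ) - (X.card : ℝ) / n) ^ 2 else 0) ≤
      100 * (1 + Real.log n) * lam * ((X.card : ℝ) ^ 2 / n) * Real.log (4 * n * n.factorial / X.card) := by
  classical
  -- notation
  set α : ℝ := (X.card : ℝ) with hα
  have hα0 : 0 < α := by rw [hα]; exact_mod_cast hX.card_pos
  have hnR : (1 : ℝ) ≤ n := by exact_mod_cast hn
  have hn0 : (0 : ℝ) < n := by linarith
  have hlam0 : 0 < lam := by linarith
  set M : Fin n → Fin n → ℝ := fun i j => ((X.filter fun x => x j = i).card : ℝ) with hM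
  -- the test function, supported on the light cells
  set η : Fin n → Fin n → ℝ := fun i j =>
    if M i j < lam * α / n then (M i j - α / n) * (n / (lam * α)) else 0 with hη
  have hM0 : ∀ i j, 0 ≤ M i j := fun i j => Nat.cast_nonneg _
  have hunit : (lam * α / n) * (n / (lam * α)) = 1 := by field_simp
  have hηlight : ∀ i j, M i j < lam * α / n → η i j = (M i j - α / n) * (n / (lam * α)) :=
    fun i j h => by simp only [hη, if_pos h]
  have hηheavy : ∀ i j, ¬ M i j < lam * α / n → η i j = 0 := fun i j h => by
    simp only [hη, if_neg h]
  have hη1 : ∀ i j, η i j ≤ 1 := fun i j => by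
    by_cases h : M i j < lam * α / n
    · rw [hηlight i j h]
      have h1 : M i j - α / n ≤ lam * α / n := by linarith [div_nonneg hα0.le hn0.le]
      calc (M i j - α / n) * (n / (lam * α)) ≤ (lam * α / n) * (n / (lam * α)) :=
            mul_le_mul_of_nonneg_right h1 (by positivity)
        _ = 1 := hunit
    · rw [hηheavy i j h]; exact zero_le_one
  have hηm1 : ∀ i j, -1 ≤ η i j := fun i j => by
    by_cases h : M i j < lam * α / n
    · rw [hηlight i j h]
      have h1 : -(α / n) ≤ M i j - α / n := by linarith [hM0 i j]
      have h2 : -(α / n) * (n / (lam * α)) ≤ (M i j - α / n) * (n / (lam * α)) :=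
        mul_le_mul_of_nonneg_right h1 (by positivity)
      have h3 : -(α / n) * (n / (lam * α)) = -(1 / lam) := by field_simp
      rw [h3] at h2
      have h4 : 1 / lam ≤ 1 := by rw [div_le_one hlam0]; exact hlam
      linarith
    · rw [hηheavy i j h]; norm_num
  -- on the light cells `M = α/n + (λα/n) η`
  have hMη : ∀ i j, M i j < lam * α / n → M i j = α / n + (lam * α / n) * η i j := fun i j h => by
    rw [hηlight i j h]
    calc M i j = α / n + ((lam * α / n) * (n / (lam * α))) * (M i j - α / n) := by rw [hunit]; ring
      _ = α / n + (lam * α / n) * ((M i j - α / n) * (n / (lam * α))) := by ring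
  -- cellwise `η · M = (α/n) η + (λα/n) η²` (both sides vanish on the heavy cells)
  have hηM : ∀ i j, η i j * M i j = α / n * η i j + lam * α / n * η i j ^ 2 := fun i j => by
    by_cases h : M i j < lam * α / n
    · have e := hMη i j h
      calc η i j * M i j = η i j * (α / n + (lam * α / n) * η i j) := by rw [← e]
        _ = α / n * η i j + lam * α / n * η i j ^ 2 := by ring
    · rw [hηheavy i j h]; ring
  -- the mean `m = (Σ η)/n ≥ -n`
  set m : ℝ := (∑ j : Fin n, ∑ i : Fin n, η i j) / n with hm
  have hmlow : -(n : ℝ) ≤ m := by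
    have h1 : ∑ j : Fin n, ∑ i : Fin n, (-1 : ℝ) ≤ ∑ j : Fin n, ∑ i : Fin n, η i j :=
      Finset.sum_le_sum fun j _ => Finset.sum_le_sum fun i _ => hηm1 i j
    have h2 : ∑ j : Fin n, ∑ i : Fin n, (-1 : ℝ) = -((n : ℝ) * n) := by
      simp only [Finset.sum_const, Finset.card_univ, Fintype.card_fin, nsmul_eq_mul]; ring
    rw [hm, le_div_iff₀ hn0]
    linarith
  have hS : ∑ j : Fin n, ∑ i : Fin n, η i j = n * m := by
    rw [hm]; field_simp
  -- the variance proxy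
  set v : ℝ := (∑ j : Fin n, ∑ i : Fin n, η i j ^ 2) / n with hv
  have hv0 : 0 ≤ v :=
    div_nonneg (Finset.sum_nonneg fun _ _ => Finset.sum_nonneg fun _ _ => sq_nonneg _) hn0.le
  have hV : ∑ j : Fin n, ∑ i : Fin n, η i j ^ 2 = n * v := by
    rw [hv]; field_simp
  -- KEY IDENTITY: `Σ_{x ∈ X} F(x) = α m + λ α v`
  have hkey : ∑ x ∈ X, ∑ j : Fin n, η (x j) j = α * m + lam * α * v := by
    rw [sum_sum_apply_eq_sum_mul_marginal X η]
    simp_rw [show ∀ i j, η i j * ((X.filter fun x => x j = i).card : ℝ) = η i j * M i j from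
      fun i j => rfl, hηM]
    simp_rw [Finset.sum_add_distrib, ← Finset.mul_sum]
    rw [Finset.sum_comm (s := Finset.univ) (t := Finset.univ) (f := fun i j => η i j), hS,
      Finset.sum_comm (s := Finset.univ) (t := Finset.univ) (f := fun i j => η i j ^ 2), hV]
    have e1 : α / n * (n * m) = α * m := by field_simp
    have e2 : lam * α / n * (n * v) = lam * α * v := by field_simp
    rw [e1, e2]
  have hkey' : ∑ x ∈ X, (∑ j : Fin n, η (x j) j - m) = lam * α * v := by
    rw [Finset.sum_sub_distrib, hkey, Finset.sum_const, nsmul_eq_mul, ← hα]; ring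
  -- `F - m ≤ 2n` pointwise
  have hFle : ∀ x : Equiv.Perm (Fin n), ∑ j : Fin n, η (x j) j - m ≤ 2 * n := fun x => by
    have h1 : ∑ j : Fin n, η (x j) j ≤ n := by
      calc ∑ j : Fin n, η (x j) j ≤ ∑ _j : Fin n, (1 : ℝ) := Finset.sum_le_sum fun j _ => hη1 _ _
        _ = n := by simp
    linarith
  -- the threshold
  set L : ℝ := Real.log (4 * n * n.factorial / X.card) with hL
  set G : ℝ := 1 + Real.log n with hG
  have hG1 : 1 ≤ G := by rw [hG]; linarith [Real.log_nonneg hnR]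
  have hY : 4 ≤ 4 * n * n.factorial / α := by
    rw [le_div_iff₀ hα0]
    have hf : (1 : ℝ) ≤ n.factorial := by exact_mod_cast n.factorial_pos
    have hαle : α ≤ n.factorial := by
      rw [hα]
      have : X.card ≤ Fintype.card (Equiv.Perm (Fin n)) := Finset.card_le_univ _
      rw [Fintype.card_perm, Fintype.card_fin] at this
      exact_mod_cast this
    nlinarith
  have hY0 : 0 < 4 * n * n.factorial / α := by linarith
  have hL1 : 1 ≤ L := by
    rw [hL, ← hα, Real.le_log_iff_exp_le hY0]
    exact le_trans Real.exp_one_lt_d9.le (by linarith)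
  have hL0 : 0 < L := by linarith
  set r : ℝ := Real.sqrt (64 * G * v * L) with hr
  have hr0 : 0 ≤ r := Real.sqrt_nonneg _
  have h64 : 0 ≤ 64 * G * v * L := by
    have : 0 ≤ G * v := mul_nonneg (by linarith) hv0
    nlinarith [hL0.le]
  have hrsq : r * r = 64 * G * v * L := Real.mul_self_sqrt h64
  set t₀ : ℝ := r + 16 * L with ht₀
  have ht₀0 : 0 < t₀ := by rw [ht₀]; linarith
  have hproxy : 32 * (1 + Real.log n) * (∑ j : Fin n, ∑ i : Fin n, η i j ^ 2) / n = 32 * G * v := by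
    rw [hv, hG]; ring
  have hden0 : 0 < 32 * G * v + 8 * 1 * t₀ := by
    have : 0 ≤ G * v := mul_nonneg (by linarith) hv0
    linarith
  have hexp : L ≤ t₀ ^ 2 / (32 * G * v + 8 * 1 * t₀) := by
    rw [le_div_iff₀ hden0, ht₀]
    nlinarith [hrsq, hr0, hL0.le, mul_nonneg hr0 hL0.le, mul_nonneg (by linarith : (0 : ℝ) ≤ G) hv0]
  -- Bernstein for `a j i := η i j ∈ [-1, 1]`, with the mean `m` kept
  have hBound := card_permutedSum_tail_le (n := n) 1 (fun j i => η i j) (fun j i => by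
    rw [abs_le]; exact ⟨hηm1 i j, hη1 i j⟩) t₀ ht₀0
  rw [hproxy, ← hm] at hBound
  have htail : 2 * (n.factorial : ℝ) *
      Real.exp (-(t₀ ^ 2 / (32 * G * v + 8 * 1 * t₀))) ≤ α / n := by
    have h1 : Real.exp (-(t₀ ^ 2 / (32 * G * v + 8 * 1 * t₀))) ≤ Real.exp (-L) :=
      Real.exp_le_exp.2 (neg_le_neg hexp)
    have h2 : Real.exp (-L) = α / (4 * n * n.factorial) := by
      rw [Real.exp_neg, hL, ← hα, Real.exp_log hY0, inv_div]
    have hf0 : (0 : ℝ) < n.factorial := by exact_mod_cast n.factorial_pos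
    calc 2 * (n.factorial : ℝ) * Real.exp (-(t₀ ^ 2 / (32 * G * v + 8 * 1 * t₀)))
        ≤ 2 * (n.factorial : ℝ) * Real.exp (-L) := by gcongr
      _ = α / n / 2 := by rw [h2]; field_simp; ring
      _ ≤ α / n := by linarith [div_nonneg hα0.le hn0.le]
  -- split `X` at the threshold (upper tail of `F - m`)
  set B := X.filter fun x => t₀ ≤ ∑ j : Fin n, η (x j) j - m with hB
  have hBsub : B.card ≤ (Finset.univ.filter fun π : Equiv.Perm (Fin n) =>
      t₀ ≤ |∑ j : Fin n, η (π j) j - m|).card := by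
    refine Finset.card_le_card fun x hx => ?_
    rw [Finset.mem_filter] at hx ⊢
    exact ⟨Finset.mem_univ _, hx.2.trans (le_abs_self _)⟩
  have hBcard : (B.card : ℝ) ≤ α / n := by
    calc (B.card : ℝ) ≤ ((Finset.univ.filter fun π : Equiv.Perm (Fin n) =>
          t₀ ≤ |∑ j : Fin n, η (π j) j - m|).card : ℝ) := by exact_mod_cast hBsub
      _ ≤ _ := hBound
      _ ≤ α / n := htail
  -- `λ α v = Σ_{x ∈ X} (F x - m) ≤ 2n · |B| + α t₀`
  have hsplit : lam * α * v ≤ 2 * n * B.card + α * t₀ := by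
    rw [← hkey', ← Finset.sum_filter_add_sum_filter_not X
      (fun x => t₀ ≤ ∑ j : Fin n, η (x j) j - m)]
    have h1 : ∑ x ∈ X.filter (fun x => t₀ ≤ ∑ j : Fin n, η (x j) j - m),
        (∑ j : Fin n, η (x j) j - m) ≤ 2 * n * B.card := by
      rw [← hB]
      calc ∑ x ∈ B, (∑ j : Fin n, η (x j) j - m) ≤ ∑ _x ∈ B, (2 * n : ℝ) :=
            Finset.sum_le_sum fun x _ => hFle x
        _ = 2 * n * B.card := by rw [Finset.sum_const, nsmul_eq_mul, mul_comm]
    have h2 : ∑ x ∈ X.filter (fun x => ¬ (t₀ ≤ ∑ j : Fin n, η (x j) j - m)),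
        (∑ j : Fin n, η (x j) j - m) ≤ α * t₀ := by
      calc ∑ x ∈ X.filter (fun x => ¬ (t₀ ≤ ∑ j : Fin n, η (x j) j - m)),
            (∑ j : Fin n, η (x j) j - m)
          ≤ ∑ _x ∈ X.filter (fun x => ¬ (t₀ ≤ ∑ j : Fin n, η (x j) j - m)), t₀ :=
            Finset.sum_le_sum fun x hx => (not_le.1 (Finset.mem_filter.1 hx).2).le
        _ = t₀ * (X.filter (fun x => ¬ (t₀ ≤ ∑ j : Fin n, η (x j) j - m))).card := by
            rw [Finset.sum_const, nsmul_eq_mul, mul_comm]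
        _ ≤ t₀ * α := by
            rw [hα]
            exact mul_le_mul_of_nonneg_left (by exact_mod_cast Finset.card_filter_le _ _) ht₀0.le
        _ = α * t₀ := mul_comm _ _
    linarith
  -- hence `λ v ≤ t₀ + 2`
  have hv1 : lam * v ≤ t₀ + 2 := by
    have h1 : (2 * n : ℝ) * B.card ≤ 2 * n * (α / n) :=
      mul_le_mul_of_nonneg_left hBcard (by positivity)
    have h2 : (2 * n : ℝ) * (α / n) = 2 * α := by field_simp
    rw [h2] at h1
    have h3 : α * (lam * v) ≤ α * (t₀ + 2) := by nlinarith
    exact le_of_mul_le_mul_left h3 hα0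
  -- AM-GM: with `u = λ v ≥ v`, `r = √(64 G v L) ≤ √(64 G u L) ≤ u/2 + 32 G L`
  have huL : lam * v ≤ 100 * G * L := by
    set u : ℝ := lam * v with hu
    have hvu : v ≤ u := by
      rw [hu]; nlinarith [hv0, hlam]
    have hu0 : 0 ≤ u := le_trans hv0 hvu
    have hamgm : r ≤ u / 2 + 32 * G * L := by
      have hS0 : 0 ≤ u / 2 + 32 * G * L := by
        have := mul_nonneg (by linarith : (0 : ℝ) ≤ G) hL0.le; linarith
      have hGL : 0 ≤ G * L := mul_nonneg (by linarith) hL0.le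
      have hsq : r ^ 2 ≤ (u / 2 + 32 * G * L) ^ 2 := by
        have e1 : r ^ 2 = 64 * G * v * L := by rw [sq]; exact hrsq
        have e2 : 64 * G * v * L ≤ 64 * G * u * L := by nlinarith [hvu, hGL]
        nlinarith [sq_nonneg (u / 2 - 32 * G * L), e1, e2]
      exact (pow_le_pow_iff_left₀ hr0 hS0 two_ne_zero).1 hsq
    have : u ≤ (64 * G + 32) * L + 4 := by rw [ht₀] at hv1; linarith
    nlinarith [hG1, hL1, this, mul_nonneg (sub_nonneg.2 hG1) hL0.le,
      mul_nonneg (sub_nonneg.2 hG1) (sub_nonneg.2 hL1)]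
  -- back to `M`: `Σ_light (M - α/n)² = (λα/n)² · n · v = (λ α²/n) · (λ v)`
  have hsum : ∑ i : Fin n, ∑ j : Fin n, (if M i j < lam * α / n then (M i j - α / n) ^ 2 else 0) =
      (lam * α ^ 2 / n) * (lam * v) := by
    have hcell : ∀ i j, (if M i j < lam * α / n then (M i j - α / n) ^ 2 else 0) =
        (lam * α / n) ^ 2 * η i j ^ 2 := fun i j => by
      by_cases h : M i j < lam * α / n
      · rw [if_pos h, hηlight i j h]
        calc (M i j - α / n) ^ 2
            = ((lam * α / n) * (n / (lam * α))) ^ 2 * (M i j - α / n) ^ 2 := by rw [hunit]; ring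
          _ = (lam * α / n) ^ 2 * ((M i j - α / n) * (n / (lam * α))) ^ 2 := by ring
      · rw [if_neg h, hηheavy i j h]; ring
    calc ∑ i : Fin n, ∑ j : Fin n, (if M i j < lam * α / n then (M i j - α / n) ^ 2 else 0)
        = ∑ i : Fin n, ∑ j : Fin n, (lam * α / n) ^ 2 * η i j ^ 2 :=
          Finset.sum_congr rfl fun i _ => Finset.sum_congr rfl fun j _ => hcell i j
      _ = (lam * α / n) ^ 2 * ∑ i : Fin n, ∑ j : Fin n, η i j ^ 2 := by
          rw [Finset.mul_sum]
          refine Finset.sum_congr rfl fun i _ => ?_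
          rw [Finset.mul_sum]
      _ = (lam * α ^ 2 / n) * (lam * v) := by
          rw [hv, Finset.sum_comm (s := Finset.univ) (t := Finset.univ) (f := fun j i => η i j ^ 2)]
          field_simp
  calc ∑ i : Fin n, ∑ j : Fin n,
        (if ((X.filter fun x => x j = i).card : ℝ) < lam * X.card / n then
          (((X.filter fun x => x j = i).card : ℝ) - (X.card : ℝ) / n) ^ 2 else 0)
      = ∑ i : Fin n, ∑ j : Fin n, (if M i j < lam * α / n then (M i j - α / n) ^ 2 else 0) := rfl
    _ = (lam * α ^ 2 / n) * (lam * v) := hsum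
    _ ≤ (lam * α ^ 2 / n) * (100 * G * L) :=
        mul_le_mul_of_nonneg_left huL (div_nonneg (mul_nonneg hlam0.le (sq_nonneg α)) hn0.le)
    _ = 100 * (1 + Real.log n) * lam * ((X.card : ℝ) ^ 2 / n) *
          Real.log (4 * n * n.factorial / X.card) := by
        rw [hL, hG, ← hα]; ring

end Summit.MatrixMultiplication.MatrixMultiplication.Theorems.PolynomialSlack
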